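import Mathlib
import HarnessLib
import Summits.HubbardSuperconductivity.HubbardSuperconductivity.Theorems.WeakCouplingBCSKlCertTrigQuadrature

/-!
# Route `WeakCouplingBCS` — support item `WcbcsKohnLuttingerB1g` (stmt-HubbardSuperconductivity-0158):
# chains, chunking and the `D₄` reduction for the quadrature of `∫ w_μ · Φ²` (R2dCERT rung R3, part 2)

Continuation of `WeakCouplingBCSKlCertTrigQuadrature.lean` (cell gate-hubbard-kl, HOME/eng/ENCLOSURES-SCOPE.md (c) R3):

* `tLowerSum / tUpperSum` — the zero-order Riemann brackets of `∫ w_μ Φ²` over a chain of `DOSCell`s (outward `2⁻³²` rounding) and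
  **`tchain_bounds`**: `chainOK μq s l = true → tLowerSum ≤ ∫_s^{end} w_μ Φ² ≤ tUpperSum`;
* chunking lemmas `endOf_append`, `chainOK_append`, `tLowerSum_append`, `tUpperSum_append` — so that a long chain is certified by SEVERAL
  `decide +kernel` calls each under the default heartbeat budget (one decision over ~500 cells is not: measured);
* **`integral_eq_eight_mul_of_symm`** — `∫_{-π}^{π} g = 8∫₀^{π/4} g` for continuous `g` with `g(θ + π/2) = g(θ)`, `g(-θ) = g(θ)`; the `B1g`
  pattern lemmas `eval_add_pi_div_two_of_twoModFour` (`eval (θ + π/2) = -eval θ` for cosine frequencies `≡ 2 (mod 4)`), `eval_neg_of_cosOnly`,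
  and **`integral_g_eq_eight_mul`** for `g = w_μ · (t.eval)²`;
* **`quarter_tintegral_mem`** — the assembled certificate for `∫₀^{π/4} w_μ Φ²` from a short and a long certified chain.

Everything is proved; definitions are the checker's rational bookkeeping. [folklore]
-/

noncomputable section

-- the tree's namespace `Summit.<Summit>.<Problem>.Theorems` repeats the summit name by design (D-0017)
set_option linter.dupNamespace false

namespace Summit.HubbardSuperconductivity.HubbardSuperconductivity.Theorems.KlCertQuad

open Real Set MeasureTheory intervalIntegral CwKLChiralWindow Literature.MathematicalPhysics.QuantumLattice

/-! ### Chains -/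

/-- Lower Riemann bracket of `∫ w_μ Φ²` over a chain (outward rounded). [folklore] -/
def tLowerSum (t : KLTrig) : List DOSCell → ℚ
  | [] => 0
  | c :: l => (c.b - c.a) * dyDown (c.gLo t) + tLowerSum t l

/-- Upper Riemann bracket of `∫ w_μ Φ²` over a chain (outward rounded). [folklore] -/
def tUpperSum (t : KLTrig) : List DOSCell → ℚ
  | [] => 0
  | c :: l => (c.b - c.a) * dyUp (c.gHi t) + tUpperSum t l

section TChain

variable {μq : ℚ} (hμ₁ : -4 < ((μq : ℚ) : ℝ)) (hμ₂ : ((μq : ℚ) : ℝ) < 0) (t : KLTrig)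
include hμ₁ hμ₂

/-- The integrand `w_μ Φ²` is continuous, hence interval integrable. [folklore] -/
theorem intervalIntegrable_g (s u : ℝ) :
    IntervalIntegrable (fun θ => fermiPolarDOS (μq : ℝ) θ * t.eval θ ^ 2) volume s u :=
  ((continuous_fermiPolarDOS hμ₁ hμ₂).mul ((kl_tr_continuous_eval t).pow 2)).intervalIntegrable _ _

/-- **Chains are sound for `∫ w_μ Φ²`.** [folklore] -/
theorem tchain_bounds : ∀ (l : List DOSCell) (s : ℚ), chainOK μq s l = true →
    ((tLowerSum t l : ℚ) : ℝ) ≤ ∫ θ in ((s : ℚ) : ℝ)..((endOf s l : ℚ) : ℝ), fermiPolarDOS (μq : ℝ) θ * t.eval θ ^ 2 ∧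
      ∫ θ in ((s : ℚ) : ℝ)..((endOf s l : ℚ) : ℝ), fermiPolarDOS (μq : ℝ) θ * t.eval θ ^ 2 ≤ ((tUpperSum t l : ℚ) : ℝ)
  | [], s, _ => by simp [tLowerSum, tUpperSum, endOf]
  | c :: l, s, h => by
    simp only [chainOK, Bool.and_eq_true, decide_eq_true_eq] at h
    obtain ⟨⟨hs, hc⟩, hl⟩ := h
    obtain ⟨ih₁, ih₂⟩ := tchain_bounds l c.b hl
    obtain ⟨⟨-, hab, -⟩, -⟩ := DOSCell.ok_spec hc
    have hab' : ((c.a : ℚ) : ℝ) ≤ c.b := by exact_mod_cast hab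
    have hba0 : (0 : ℝ) ≤ ((c.b : ℚ) : ℝ) - c.a := by linarith
    have hI := intervalIntegrable_g hμ₁ hμ₂ t ((c.a : ℚ) : ℝ) ((c.b : ℚ) : ℝ)
    have hdn : ((dyDown (c.gLo t) : ℚ) : ℝ) ≤ c.gLo t := by exact_mod_cast dyDown_le _
    have hup : ((c.gHi t : ℚ) : ℝ) ≤ dyUp (c.gHi t) := by exact_mod_cast le_dyUp _
    have hc₁ : (((c.b - c.a) * dyDown (c.gLo t) : ℚ) : ℝ) ≤
        ∫ θ in ((c.a : ℚ) : ℝ)..((c.b : ℚ) : ℝ), fermiPolarDOS (μq : ℝ) θ * t.eval θ ^ 2 := by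
      have h := intervalIntegral.integral_mono_on hab' intervalIntegrable_const hI
        (fun θ hθ => (DOSCell.g_mem hμ₁ hμ₂ hc t hθ.1 hθ.2).1)
      rw [intervalIntegral.integral_const, smul_eq_mul] at h
      push_cast; nlinarith [mul_le_mul_of_nonneg_left hdn hba0]
    have hc₂ : ∫ θ in ((c.a : ℚ) : ℝ)..((c.b : ℚ) : ℝ), fermiPolarDOS (μq : ℝ) θ * t.eval θ ^ 2 ≤
        (((c.b - c.a) * dyUp (c.gHi t) : ℚ) : ℝ) := by
      have h := intervalIntegral.integral_mono_on hab' hI intervalIntegrable_const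
        (fun θ hθ => (DOSCell.g_mem hμ₁ hμ₂ hc t hθ.1 hθ.2).2)
      rw [intervalIntegral.integral_const, smul_eq_mul] at h
      push_cast; nlinarith [mul_le_mul_of_nonneg_left hup hba0]
    rw [endOf, tLowerSum, tUpperSum, ← hs]
    have hsplit := (intervalIntegral.integral_add_adjacent_intervals hI
      (intervalIntegrable_g hμ₁ hμ₂ t ((c.b : ℚ) : ℝ) ((endOf c.b l : ℚ) : ℝ))).symm
    rw [hsplit]
    push_cast at hc₁ hc₂ ⊢
    constructor <;> linarith

end TChain

/-! ### Chunking (keeps every kernel decision under the default heartbeat budget) -/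

/-- `endOf` of a concatenation. [folklore] -/
theorem endOf_append (s : ℚ) (l₁ l₂ : List DOSCell) : endOf s (l₁ ++ l₂) = endOf (endOf s l₁) l₂ := by
  induction l₁ generalizing s with
  | nil => rfl
  | cons c l ih => exact ih c.b

/-- `chainOK` of a concatenation. [folklore] -/
theorem chainOK_append (μq s : ℚ) (l₁ l₂ : List DOSCell) :
    chainOK μq s (l₁ ++ l₂) = (chainOK μq s l₁ && chainOK μq (endOf s l₁) l₂) := by
  induction l₁ generalizing s with
  | nil => simp [chainOK, endOf]
  | cons c l ih => simp [chainOK, endOf, ih, Bool.and_assoc]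

/-- `tLowerSum` of a concatenation. [folklore] -/
theorem tLowerSum_append (t : KLTrig) (l₁ l₂ : List DOSCell) :
    tLowerSum t (l₁ ++ l₂) = tLowerSum t l₁ + tLowerSum t l₂ := by
  induction l₁ with
  | nil => simp [tLowerSum]
  | cons c l ih => simp [tLowerSum, ih, add_assoc]

/-- `tUpperSum` of a concatenation. [folklore] -/
theorem tUpperSum_append (t : KLTrig) (l₁ l₂ : List DOSCell) :
    tUpperSum t (l₁ ++ l₂) = tUpperSum t l₁ + tUpperSum t l₂ := by
  induction l₁ with
  | nil => simp [tUpperSum]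
  | cons c l ih => simp [tUpperSum, ih, add_assoc]

/-! ### The `D₄` reduction for a symmetric integrand -/

/-- **`∫_{-π}^{π} g = 8 ∫₀^{π/4} g`** for a continuous `g` with `g(θ + π/2) = g(θ)` and `g(-θ) = g(θ)`. [folklore] -/
theorem integral_eq_eight_mul_of_symm {g : ℝ → ℝ} (hg : Continuous g) (hq : ∀ θ, g (θ + π / 2) = g θ)
    (hn : ∀ θ, g (-θ) = g θ) :
    ∫ θ in (-π)..π, g θ = 8 * ∫ θ in (0 : ℝ)..(π / 4), g θ := by
  have hI : ∀ s u : ℝ, IntervalIntegrable g volume s u := fun s u => hg.intervalIntegrable _ _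
  have hshift : ∀ s u : ℝ, ∫ θ in s..u, g θ = ∫ θ in (s + π / 2)..(u + π / 2), g θ := by
    intro s u
    rw [← intervalIntegral.integral_comp_add_right g (π / 2)]
    simp_rw [hq]
  have h1 : ∫ θ in (-π)..(-π + π / 2), g θ = ∫ θ in (0 : ℝ)..(π / 2), g θ := by
    rw [hshift, hshift]; congr 1 <;> ring
  have h2 : ∫ θ in (-π + π / 2)..0, g θ = ∫ θ in (0 : ℝ)..(π / 2), g θ := by
    have := hshift (-π + π / 2) 0
    rw [show -π + π / 2 + π / 2 = (0 : ℝ) by ring, show (0 : ℝ) + π / 2 = π / 2 by ring] at this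
    exact this
  have h3 : ∫ θ in (π / 2)..π, g θ = ∫ θ in (0 : ℝ)..(π / 2), g θ := by
    have := hshift 0 (π / 2)
    rw [zero_add, show π / 2 + π / 2 = π by ring] at this
    exact this.symm
  have hsub : ∀ θ, g (π / 2 - θ) = g θ := fun θ => by rw [sub_eq_neg_add, hq, hn]
  have h4 : ∫ θ in (π / 4)..(π / 2), g θ = ∫ θ in (0 : ℝ)..(π / 4), g θ := by
    have := intervalIntegral.integral_comp_sub_left g (π / 2) (a := 0) (b := π / 4)
    simp_rw [hsub] at this
    rw [show π / 2 - π / 4 = π / 4 by ring, sub_zero] at this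
    exact this.symm
  have hhalf : ∫ θ in (0 : ℝ)..(π / 2), g θ = 2 * ∫ θ in (0 : ℝ)..(π / 4), g θ := by
    rw [← intervalIntegral.integral_add_adjacent_intervals (hI 0 (π / 4)) (hI (π / 4) (π / 2)), h4]; ring
  rw [← intervalIntegral.integral_add_adjacent_intervals (hI (-π) (-π + π / 2)) (hI (-π + π / 2) π),
    ← intervalIntegral.integral_add_adjacent_intervals (hI (-π + π / 2) 0) (hI 0 π),
    ← intervalIntegral.integral_add_adjacent_intervals (hI 0 (π / 2)) (hI (π / 2) π), h1, h2, h3, hhalf]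
  ring

/-- A list of cosine frequencies is `≡ 2 (mod 4)` throughout. [folklore] -/
def allTwoModFour (L : List (ℕ × ℚ)) : Bool := L.all fun p => p.1 % 4 == 2

/-- For cosines of frequency `≡ 2 (mod 4)` and no sines: `eval (θ + π/2) = -eval θ`. [folklore] -/
theorem eval_add_pi_div_two_of_twoModFour (t : KLTrig) (hc : allTwoModFour t.cosC = true) (hs : t.sinC = []) (θ : ℝ) :
    t.eval (θ + π / 2) = -t.eval θ := by
  rw [KLTrig.eval, KLTrig.eval, hs]
  simp only [List.map_nil, List.sum_nil, add_zero]
  have key : ∀ L : List (ℕ × ℚ), allTwoModFour L = true →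
      (L.map fun p : ℕ × ℚ => (p.2 : ℝ) * Real.cos ((p.1 : ℝ) * (θ + π / 2))).sum =
        -(L.map fun p : ℕ × ℚ => (p.2 : ℝ) * Real.cos ((p.1 : ℝ) * θ)).sum := by
    intro L hL
    induction L with
    | nil => simp
    | cons p L ih =>
      simp only [allTwoModFour, List.all_cons, Bool.and_eq_true, beq_iff_eq] at hL
      obtain ⟨hp, hL'⟩ := hL
      simp only [List.map_cons, List.sum_cons, neg_add]
      rw [ih (by simpa [allTwoModFour] using hL')]
      congr 1
      -- `p.1 = 4k + 2`: `cos(p.1 θ + p.1 π/2) = cos(p.1 θ + π + 2kπ) = -cos(p.1 θ)`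
      obtain ⟨k, hk⟩ : ∃ k, p.1 = 4 * k + 2 := ⟨p.1 / 4, by omega⟩
      have : (p.1 : ℝ) * (θ + π / 2) = (p.1 : ℝ) * θ + ((k : ℕ) : ℤ) * (2 * π) + π := by
        rw [hk]; push_cast; ring
      rw [this, Real.cos_add_pi, Real.cos_add_int_mul_two_pi, mul_neg]
  exact key t.cosC hc

/-- For cosines only: `eval (-θ) = eval θ`. [folklore] -/
theorem eval_neg_of_cosOnly (t : KLTrig) (hs : t.sinC = []) (θ : ℝ) : t.eval (-θ) = t.eval θ := by
  rw [KLTrig.eval, KLTrig.eval, hs]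
  simp only [List.map_nil, List.sum_nil, add_zero, mul_neg, Real.cos_neg]

/-- The integrand `w_μ · Φ²` of a `B1g`-type cosine trial has the `D₄` symmetry, so `∫_{-π}^{π} = 8∫₀^{π/4}`. [folklore] -/
theorem integral_g_eq_eight_mul {μ : ℝ} (hμ₁ : -4 < μ) (hμ₂ : μ < 0) (t : KLTrig) (hc : allTwoModFour t.cosC = true)
    (hs : t.sinC = []) :
    ∫ θ in (-π)..π, fermiPolarDOS μ θ * t.eval θ ^ 2 = 8 * ∫ θ in (0 : ℝ)..(π / 4), fermiPolarDOS μ θ * t.eval θ ^ 2 :=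
  integral_eq_eight_mul_of_symm ((continuous_fermiPolarDOS hμ₁ hμ₂).mul ((kl_tr_continuous_eval t).pow 2))
    (fun θ => by rw [fermiPolarDOS_add_pi_div_two' hμ₁ hμ₂, eval_add_pi_div_two_of_twoModFour t hc hs, neg_sq])
    (fun θ => by rw [fermiPolarDOS_neg' hμ₁ hμ₂, eval_neg_of_cosOnly t hs])

/-- **The assembled certificate for `∫₀^{π/4} w_μ Φ²`** from a short and a long certified chain. [folklore] -/
theorem quarter_tintegral_mem {μq : ℚ} (hμ₁ : -4 < ((μq : ℚ) : ℝ)) (hμ₂ : ((μq : ℚ) : ℝ) < 0) (t : KLTrig)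
    {short long : List DOSCell} (hshort : chainOK μq 0 short = true) (hlong : chainOK μq 0 long = true)
    (he₁ : endOf 0 short ≤ pi4Lo) (he₂ : pi4Hi ≤ endOf 0 long) :
    ((tLowerSum t short : ℚ) : ℝ) ≤ ∫ θ in (0 : ℝ)..(π / 4), fermiPolarDOS (μq : ℝ) θ * t.eval θ ^ 2 ∧
      ∫ θ in (0 : ℝ)..(π / 4), fermiPolarDOS (μq : ℝ) θ * t.eval θ ^ 2 ≤ ((tUpperSum t long : ℚ) : ℝ) := by
  obtain ⟨h₁, -⟩ := tchain_bounds hμ₁ hμ₂ t short 0 hshort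
  obtain ⟨-, h₂⟩ := tchain_bounds hμ₁ hμ₂ t long 0 hlong
  push_cast at h₁ h₂
  have he₁' : ((endOf 0 short : ℚ) : ℝ) ≤ π / 4 := (show ((endOf 0 short : ℚ) : ℝ) ≤ pi4Lo by exact_mod_cast he₁).trans pi4Lo_lt.le
  have he₂' : π / 4 ≤ ((endOf 0 long : ℚ) : ℝ) := lt_pi4Hi.le.trans (by exact_mod_cast he₂)
  have hend : ∀ (l : List DOSCell) (s : ℚ), chainOK μq s l = true → s ≤ endOf s l := by
    intro l
    induction l with
    | nil => intro s _; simp [endOf]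
    | cons c l ih =>
      intro s h
      simp only [chainOK, Bool.and_eq_true, decide_eq_true_eq] at h
      obtain ⟨⟨hs, hc⟩, hl⟩ := h
      obtain ⟨⟨-, hab, -⟩, -⟩ := DOSCell.ok_spec hc
      rw [endOf, ← hs]
      exact hab.trans (ih c.b hl)
  have h0₁ : (0 : ℝ) ≤ ((endOf 0 short : ℚ) : ℝ) := by exact_mod_cast hend short 0 hshort
  have hg0 : ∀ θ, 0 ≤ fermiPolarDOS (μq : ℝ) θ * t.eval θ ^ 2 :=
    fun θ => mul_nonneg (fermiPolarDOS_pos hμ₁ hμ₂ θ).le (sq_nonneg _)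
  have hmono : ∀ {s u : ℝ}, 0 ≤ s → s ≤ u →
      ∫ θ in (0 : ℝ)..s, fermiPolarDOS (μq : ℝ) θ * t.eval θ ^ 2 ≤ ∫ θ in (0 : ℝ)..u, fermiPolarDOS (μq : ℝ) θ * t.eval θ ^ 2 :=
    fun hs hsu => intervalIntegral.integral_mono_interval le_rfl hs hsu (Filter.Eventually.of_forall hg0)
      (intervalIntegrable_g hμ₁ hμ₂ t _ _)
  constructor
  · exact h₁.trans (hmono h0₁ he₁')
  · exact (hmono (by linarith [Real.pi_pos]) he₂').trans h₂

end Summit.HubbardSuperconductivity.HubbardSuperconductivity.Theorems.KlCertQuad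

end
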